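import Summits.QuantumFields.YangMills.Theorems.BalabanLadderNTLinkVarianceFloor
import Summits.QuantumFields.YangMills.Theorems.BalabanLadderNTLinkGaussianTail
import Summits.QuantumFields.YangMills.Theorems.BalabanLadderNTOnePointFloor
import HarnessLib

/-!
# Crux `NT` (stmt-QuantumFields-19353): the one-link kernel CEILING on consistent exteriors — no consistent exterior heats a link
# beyond `C/β` — and the one-link variance floor under consistency alone (hypothesis-free)

Fleet lead prover of crux `NT` (unit `ym-spine-19353-p1`, g30).  Sequel of `Theorems/BalabanLadderNTLinkVarianceFloor` (whose
hypothesis (b), «tilted mean of `u_k` is `≤ C/β`», this file DISCHARGES from consistency alone), of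
`Theorems/BalabanLadderNTLinkGaussianTail` (the Gaussian Haar bound) and the ceiling twin of g9's exterior-uniform kernel floor
`θ/(2β) ≤ ∫ S_e dγ_e(·|ω)` (`Theorems/BalabanLadderNTOnePointFloor`):

* §1 **`linkCost_tilted_mean_le`** — for `θ/β`-consistent staples (`u_k(g₀) ≤ θ/β`, `#ι ≤ m₀`) the Gibbs-tilted mean of the
  one-link cost is `≤ C/β`: `∫ u_k e^{−βu_k} dσ ≤ (C/β) ∫ e^{−βu_k} dσ` (`x e^{−x/2} ≤ 2/e`, the pinch
  `u_k ≥ u_k(g₀) + r²/4 − 2m₀θ/β`, the Gaussian bound; below by the small ball `r ≤ 1/√β`);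
  **`linkCost_variance_floor_of_consistent`** — the one-link VARIANCE FLOOR of the prequel with hypothesis (b) removed;
* §2 kernel form: **`kernel_linkAction_le_of_consistent`** — for every dimension `d`, link `e` on `≤ m₀` plaquettes and EVERY
  exterior `ω` with `S_e(ω) ≤ θ/β`: `∫ S_e dγ_e(·|ω) ≤ C/β` — together with g9's floor, the TWO-SIDED one-link kernel pin on
  consistent exteriors.

HONEST FRAMING.  Finite-dimensional analysis on a compact group; a CONDITIONAL (consistent-exterior) one-point ceiling at lattice
scale; nothing about depth, decay, NT's physical scale, the seam or the gap; NT is NOT proved; not Clay.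
Refs: Montvay–Münster 1994 §3.2; Seiler LNP 159 Ch. 2.
-/

set_option autoImplicit false

noncomputable section

open scoped Matrix Matrix.Norms.Frobenius ENNReal NNReal Topology BigOperators
open MeasureTheory Measure Filter Set Metric
open Literature.MathematicalPhysics.QuantumLattice
open Literature.MathematicalPhysics.QuantumFieldTheory hiding ZdEdge
open Summit.QuantumFields.YangMills.Theorems.FreeEnergyLogCoefficient

namespace Summit.QuantumFields.YangMills.Cruxes.NT.LinkEquipartition

/-! ## §1 The tilted mean of the one-link cost on consistent staples; the variance floor under consistency alone -/

section Ceiling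

variable {N : ℕ} {G : Type*} [Group G] [TopologicalSpace G] [IsTopologicalGroup G] [CompactSpace G]
  [MeasurableSpace G] [BorelSpace G] (ρ : G →* Matrix (Fin N) (Fin N) ℂ)

/-- **NO CONSISTENT EXTERIOR HEATS A LINK BEYOND `C/β`.**  For a compact group with a faithful continuous unitary representation
and every `θ ≥ 0`, `m₀` there are `C, β₀ > 0` such that for every `β ≥ β₀`, every non-empty staple
family `k` of size `≤ m₀` and every base point `g₀` with `u_k(g₀) ≤ θ/β`:
`∫ u_k e^{−β u_k} dσ ≤ (C/β) ∫ e^{−β u_k} dσ`. [folklore] -/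
theorem linkCost_tilted_mean_le (hρ : Continuous ρ) (hinj : Function.Injective ρ)
    (hU : ∀ g, ρ g ∈ Matrix.unitaryGroup (Fin N) ℂ) {θ : ℝ} (hθ : 0 ≤ θ) (m₀ : ℕ) :
    ∃ C β₀ : ℝ, 0 < C ∧ 0 < β₀ ∧ ∀ β : ℝ, β₀ ≤ β →
      ∀ (ι : Type) [Fintype ι] [Nonempty ι] (k : ι → G), Fintype.card ι ≤ m₀ →
      ∀ g₀ : G, linkCost ρ k g₀ ≤ θ / β →
        ∫ h, linkCost ρ k h * Real.exp (-β * linkCost ρ k h) ∂(haarProbability G) ≤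
          C / β * ∫ h, Real.exp (-β * linkCost ρ k h) ∂(haarProbability G) := by
  obtain ⟨δ₀, c₁, c₂, hδ₀, hc₁, hc₂, hball⟩ := exists_haar_gball_two_sided ρ hρ hinj hU
  obtain ⟨K, hK, hgauss⟩ := exists_integral_exp_neg_mul_normSq_le ρ hρ hinj hU (c := 1 / 8) (by norm_num)
  set D : ℕ := dimE ρ with hDdef
  set M : ℝ := (m₀ : ℝ) with hM
  have hM0 : 0 ≤ M := Nat.cast_nonneg _
  set t : ℝ := Real.sqrt (2 * θ) with ht
  have ht0 : 0 ≤ t := Real.sqrt_nonneg _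
  set A₁ : ℝ := M / 2 + M * t with hA₁
  set C : ℝ := 2 * Real.exp (M * θ + A₁ + θ / 2) * K / c₁ with hC
  have hC0 : 0 < C := by positivity
  set β₀ : ℝ := max 1 (1 / δ₀ ^ 2) with hβ₀
  refine ⟨C, β₀, hC0, lt_of_lt_of_le one_pos (le_max_left _ _), ?_⟩
  intro β hβ ι _ _ k hk g₀ hu₀
  have hβ1 : 1 ≤ β := (le_max_left _ _).trans hβ
  have hβ0 : 0 < β := lt_of_lt_of_le one_pos hβ1
  set δ : ℝ := 1 / Real.sqrt β with hδ
  have hδ0 : 0 < δ := div_pos one_pos (Real.sqrt_pos.2 hβ0)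
  have hδsq : δ ^ 2 = 1 / β := by rw [hδ, one_div, inv_pow, Real.sq_sqrt hβ0.le, one_div]
  have hδδ₀ : δ ≤ δ₀ := by
    have h1 : δ ^ 2 ≤ δ₀ ^ 2 := by
      rw [hδsq, one_div_le (by positivity) (by positivity)]
      exact (le_max_right _ _).trans hβ
    exact (pow_le_pow_iff_left₀ hδ0.le hδ₀.le two_ne_zero).1 h1
  set σ := haarProbability G with hσ
  set m : ℝ := (Fintype.card ι : ℝ) with hm
  have hm1 : 1 ≤ m := by rw [hm]; exact_mod_cast Fintype.card_pos
  have hmM : m ≤ M := by rw [hm, hM]; exact_mod_cast hk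
  set u := linkCost ρ k with hu
  set u₀ := u g₀ with hu₀def
  have hucont : Continuous u := continuous_linkCost ρ hρ k
  have hunn : ∀ h, 0 ≤ u h := linkCost_nonneg ρ hU k
  set r : G → ℝ := fun h => ‖ρ h - ρ g₀‖ with hr
  have hr0 : ∀ h, 0 ≤ r h := fun h => norm_nonneg _
  have hrcont : Continuous r := (hρ.sub continuous_const).norm
  have hP : ∀ h, u h ≤ u₀ + m / 2 * r h ^ 2 + m * r h * (t * δ) ∧ u₀ + m / 4 * r h ^ 2 - 2 * m * θ / β ≤ u h :=
    fun h => ⟨(linkCost_pinch_of_consistent ρ hU k g₀ hβ0 hθ hu₀ h).2.1,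
      (linkCost_pinch_of_consistent ρ hU k g₀ hβ0 hθ hu₀ h).2.2⟩
  set w : G → ℝ := fun h => Real.exp (-β * u h) with hw
  have hwpos : ∀ h, 0 < w h := fun h => Real.exp_pos _
  have hwcont : Continuous w := Real.continuous_exp.comp (continuous_const.mul hucont)
  have hint : ∀ {f : G → ℝ}, Continuous f → Integrable f σ := fun hf =>
    hf.integrable_of_hasCompactSupport (HasCompactSupport.of_compactSpace _)
  have hwint : Integrable w σ := hint hwcont
  set E₀ : ℝ := Real.exp (-β * u₀) with hE₀
  have hE₀0 : 0 < E₀ := Real.exp_pos _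
  set Z := ∫ h, w h ∂σ with hZ
  show ∫ h, u h * w h ∂σ ≤ C / β * Z
  -- (1) the normaliser from below: the ball `r ≤ δ`
  have hZ : E₀ * Real.exp (-A₁) * (c₁ * δ ^ D) ≤ Z := by
    set R₁ : Set G := {h | r h ≤ δ} with hR₁
    have hR₁m : MeasurableSet R₁ := (isClosed_le hrcont continuous_const).measurableSet
    have hσR₁ : c₁ * δ ^ D ≤ σ.real R₁ := by
      have h := (hball δ hδ0 hδδ₀).1
      have e : σ.real R₁ = σ.real {g : G | ‖ρ g - 1‖ ≤ δ} := by
        rw [measureReal_def, measureReal_def]; exact congrArg ENNReal.toReal (haar_setOf_norm_sub_le ρ hU g₀ δ)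
      rw [e]; exact h
    have hwR₁ : ∀ h ∈ R₁, E₀ * Real.exp (-A₁) ≤ w h := by
      intro h hh
      have hrh : r h ≤ δ := hh
      have hr2 : r h ^ 2 ≤ δ ^ 2 := pow_le_pow_left₀ (hr0 h) hrh 2
      have h5 : m * r h * (t * δ) ≤ m * δ * (t * δ) :=
        mul_le_mul_of_nonneg_right (mul_le_mul_of_nonneg_left hrh (by linarith only [hm1])) (mul_nonneg ht0 hδ0.le)
      have h6 : m / 2 * r h ^ 2 ≤ m / 2 * δ ^ 2 := mul_le_mul_of_nonneg_left hr2 (by linarith only [hm1])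
      have h7 : m * t ≤ M * t := mul_le_mul_of_nonneg_right hmM ht0
      have hb : u h ≤ u₀ + (m / 2 + m * t) * δ ^ 2 := by linarith only [(hP h).1, h5, h6]
      have h8 := mul_le_mul_of_nonneg_left hb hβ0.le
      have e : β * (u₀ + (m / 2 + m * t) * δ ^ 2) = β * u₀ + (m / 2 + m * t) := by rw [hδsq]; field_simp
      rw [hE₀, ← Real.exp_add]
      refine Real.exp_le_exp.2 ?_
      rw [hA₁]
      linarith only [h8, e, h7, hmM]
    calc E₀ * Real.exp (-A₁) * (c₁ * δ ^ D) ≤ E₀ * Real.exp (-A₁) * σ.real R₁ :=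
          mul_le_mul_of_nonneg_left hσR₁ (by positivity)
      _ = ∫ h in R₁, E₀ * Real.exp (-A₁) ∂σ := by rw [setIntegral_const, smul_eq_mul, mul_comm]
      _ ≤ ∫ h in R₁, w h ∂σ := setIntegral_mono_on (integrableOn_const (measure_ne_top _ _)) hwint.integrableOn hR₁m hwR₁
      _ ≤ Z := setIntegral_le_integral hwint (ae_of_all _ fun h => (hwpos h).le)
  -- (2) the numerator from above: `u e^{−βu} ≤ (2/(eβ)) e^{−βu/2}` and the Gaussian bound
  have hnum : ∫ h, u h * w h ∂σ ≤ 2 / β * (Real.exp (-(β * u₀ / 2)) * Real.exp (M * θ)) * (K * δ ^ D) := by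
    have hpt : ∀ h, u h * w h ≤ 2 / β * (Real.exp (-(β * u₀ / 2)) * Real.exp (M * θ)) *
        Real.exp (-(1 / 8 * β * r h ^ 2)) := by
      intro h
      -- `β u/2 · e^{−βu/2} ≤ e^{-1} ≤ 1`, i.e. `u e^{−βu/2} ≤ 2/β`
      have h1 : u h * Real.exp (-(β * u h / 2)) ≤ 2 / β := by
        have hx := Real.add_one_le_exp (β * u h / 2 - 1)
        have hx' : β * u h / 2 ≤ Real.exp (β * u h / 2) := by
          have : Real.exp (β * u h / 2 - 1) ≤ Real.exp (β * u h / 2) := Real.exp_le_exp.2 (by linarith)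
          linarith
        rw [Real.exp_neg, mul_inv_le_iff₀ (Real.exp_pos _), div_mul_eq_mul_div, le_div_iff₀ hβ0]
        nlinarith [hunn h]
      -- `e^{−βu/2} ≤ e^{−βu₀/2} e^{Mθ} e^{−βr²/8}`
      have h2 : Real.exp (-(β * u h / 2)) ≤ Real.exp (-(β * u₀ / 2)) * Real.exp (M * θ) * Real.exp (-(1 / 8 * β * r h ^ 2)) := by
        rw [← Real.exp_add, ← Real.exp_add]
        refine Real.exp_le_exp.2 ?_
        have h3 := (hP h).2
        have h4 : m / 4 * r h ^ 2 ≥ 1 / 4 * r h ^ 2 := mul_le_mul_of_nonneg_right (by linarith only [hm1]) (sq_nonneg _)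
        have h5 : 2 * m * θ / β ≤ 2 * M * θ / β :=
          div_le_div_of_nonneg_right (mul_le_mul_of_nonneg_right (by linarith only [hmM]) hθ) hβ0.le
        have h6 : β * (2 * M * θ / β) = 2 * M * θ := by field_simp
        have h7 := mul_le_mul_of_nonneg_left (show u₀ + 1 / 4 * r h ^ 2 - 2 * M * θ / β ≤ u h by linarith only [h3, h4, h5]) hβ0.le
        linarith only [h7, h6]
      have e : u h * w h = (u h * Real.exp (-(β * u h / 2))) * Real.exp (-(β * u h / 2)) := by
        rw [hw, mul_assoc, ← Real.exp_add]; congr 2; ring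
      rw [e]
      calc u h * Real.exp (-(β * u h / 2)) * Real.exp (-(β * u h / 2))
          ≤ 2 / β * (Real.exp (-(β * u₀ / 2)) * Real.exp (M * θ) * Real.exp (-(1 / 8 * β * r h ^ 2))) :=
            mul_le_mul h1 h2 (Real.exp_pos _).le (by positivity)
        _ = _ := by ring
    have hgi : Integrable (fun h => Real.exp (-(1 / 8 * β * r h ^ 2))) σ :=
      hint (Real.continuous_exp.comp ((continuous_const.mul (hrcont.pow 2)).neg))
    calc ∫ h, u h * w h ∂σ ≤ ∫ h, 2 / β * (Real.exp (-(β * u₀ / 2)) * Real.exp (M * θ)) *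
          Real.exp (-(1 / 8 * β * r h ^ 2)) ∂σ := integral_mono (hint (hucont.mul hwcont)) (hgi.const_mul _) hpt
      _ = 2 / β * (Real.exp (-(β * u₀ / 2)) * Real.exp (M * θ)) * ∫ h, Real.exp (-(1 / 8 * β * r h ^ 2)) ∂σ :=
          integral_const_mul _ _
      _ ≤ 2 / β * (Real.exp (-(β * u₀ / 2)) * Real.exp (M * θ)) * (K * δ ^ D) :=
          mul_le_mul_of_nonneg_left (hgauss β hβ1 g₀) (by positivity)
  -- (3) compare: `e^{−βu₀/2} ≤ e^{θ/2} · E₀`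
  have hE : Real.exp (-(β * u₀ / 2)) ≤ Real.exp (θ / 2) * E₀ := by
    rw [hE₀, ← Real.exp_add]
    refine Real.exp_le_exp.2 ?_
    have : β * u₀ ≤ θ := by
      have := mul_le_mul_of_nonneg_left hu₀ hβ0.le
      have e : β * (θ / β) = θ := by field_simp
      linarith
    linarith
  have hfin : 2 / β * (Real.exp (-(β * u₀ / 2)) * Real.exp (M * θ)) * (K * δ ^ D) ≤ C / β * (E₀ * Real.exp (-A₁) * (c₁ * δ ^ D)) := by
    have h1 : 2 / β * (Real.exp (-(β * u₀ / 2)) * Real.exp (M * θ)) * (K * δ ^ D) ≤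
        2 / β * (Real.exp (θ / 2) * E₀ * Real.exp (M * θ)) * (K * δ ^ D) := by
      have := mul_le_mul_of_nonneg_right hE (Real.exp_pos (M * θ)).le
      have h2 : 0 ≤ 2 / β := by positivity
      have h3 : 0 ≤ K * δ ^ D := by positivity
      exact mul_le_mul_of_nonneg_right (mul_le_mul_of_nonneg_left this h2) h3
    have e : 2 / β * (Real.exp (θ / 2) * E₀ * Real.exp (M * θ)) * (K * δ ^ D) = C / β * (E₀ * Real.exp (-A₁) * (c₁ * δ ^ D)) := by
      rw [hC, show M * θ + A₁ + θ / 2 = (M * θ + θ / 2) + A₁ by ring, Real.exp_add (M * θ + θ / 2), Real.exp_add,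
        Real.exp_neg]
      field_simp
    linarith only [h1, e]
  exact hnum.trans (hfin.trans (mul_le_mul_of_nonneg_left hZ (by positivity)))

/-- **THE ONE-LINK VARIANCE FLOOR UNDER CONSISTENCY ALONE** (`linkCost_variance_floor` with its tilted-mean hypothesis
discharged by `linkCost_tilted_mean_le`): for `θ ≥ 0`, `m₀` there are `κ, β₀ > 0` with
`(κ/β²) ∫ e^{−β u_k} dσ ≤ ∫ (u_{k'} − c)² e^{−β u_k} dσ` for every `c`, all `β ≥ β₀`, all staple families `k, k'` of sizes `≤ m₀`
that are `θ/β`-consistent from a common base point. [folklore] -/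
theorem linkCost_variance_floor_of_consistent (hρ : Continuous ρ) (hinj : Function.Injective ρ)
    (hU : ∀ g, ρ g ∈ Matrix.unitaryGroup (Fin N) ℂ) (hD : 0 < dimE ρ) {θ : ℝ} (hθ : 0 ≤ θ) (m₀ : ℕ) :
    ∃ κ β₀ : ℝ, 0 < κ ∧ 0 < β₀ ∧ ∀ β : ℝ, β₀ ≤ β →
      ∀ (ι : Type) [Fintype ι] [Nonempty ι] (k : ι → G), Fintype.card ι ≤ m₀ →
      ∀ (ι' : Type) [Fintype ι'] [Nonempty ι'] (k' : ι' → G), Fintype.card ι' ≤ m₀ →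
      ∀ g₀ : G, linkCost ρ k g₀ ≤ θ / β → linkCost ρ k' g₀ ≤ θ / β →
        ∀ c : ℝ, κ / β ^ 2 * ∫ h, Real.exp (-β * linkCost ρ k h) ∂(haarProbability G) ≤
          ∫ h, (linkCost ρ k' h - c) ^ 2 * Real.exp (-β * linkCost ρ k h) ∂(haarProbability G) := by
  obtain ⟨C, β₁, hC, hβ₁, hmean⟩ := linkCost_tilted_mean_le ρ hρ hinj hU hθ m₀
  obtain ⟨κ, β₂, hκ, hβ₂, hfloor⟩ := linkCost_variance_floor ρ hρ hinj hU hD C hθ m₀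
  refine ⟨κ, max β₁ β₂, hκ, lt_of_lt_of_le hβ₁ (le_max_left _ _), ?_⟩
  intro β hβ ι _ _ k hk ι' _ _ k' hk' g₀ hu₀ hu₀' c
  exact hfloor β ((le_max_right _ _).trans hβ) ι k hk ι' k' hk' g₀ hu₀ hu₀'
    (hmean β ((le_max_left _ _).trans hβ) ι k hk g₀ hu₀) c

end Ceiling

/-! ## §2 Kernel form: the one-link kernel ceiling on consistent exteriors -/

section Kernel

variable {N : ℕ} {G : Type*} [Group G] [TopologicalSpace G] [IsTopologicalGroup G] [CompactSpace G]
  [MeasurableSpace G] [BorelSpace G] [SecondCountableTopology G] (ρ : G →* Matrix (Fin N) (Fin N) ℂ)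

/-- **THE ONE-LINK KERNEL CEILING ON CONSISTENT EXTERIORS.**  For a compact group with a faithful continuous unitary
representation and every `θ ≥ 0`, `m₀` there are `C, β₀ > 0` such that for every `β ≥ β₀`, every
dimension `d`, every link `e` on `1 ≤ #plaquettes ≤ m₀` and EVERY exterior `ω` with `S_e(ω) ≤ θ/β`:
`∫ S_e dγ_e(·|ω) ≤ C/β` — with g9's `θ'/(2β) ≤ ∫ S_e dγ_e(·|ω)` the two-sided one-link kernel pin. [folklore] -/
theorem kernel_linkAction_le_of_consistent (hρ : Continuous ρ) (hinj : Function.Injective ρ)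
    (hU : ∀ g, ρ g ∈ Matrix.unitaryGroup (Fin N) ℂ) {θ : ℝ} (hθ : 0 ≤ θ) (m₀ : ℕ) :
    ∃ C β₀ : ℝ, 0 < C ∧ 0 < β₀ ∧ ∀ β : ℝ, β₀ ≤ β → ∀ {d : ℕ} (e : ZdEdge d) (ω : LGConfig d G),
      (plaquettesTouching {e}).Nonempty → (plaquettesTouching {e}).card ≤ m₀ →
      wilsonBoundaryAction ρ {e} ω ≤ θ / β →
        ∫ U, wilsonBoundaryAction ρ {e} U ∂(ymSpecification ρ β {e} ω) ≤ C / β := by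
  classical
  obtain ⟨C, β₀, hC, hβ₀, hmean⟩ := linkCost_tilted_mean_le ρ hρ hinj hU hθ m₀
  refine ⟨C, β₀, hC, hβ₀, fun β hβ d e ω hne hcard hS => ?_⟩
  haveI : Nonempty ↥(plaquettesTouching {e}) := hne.coe_sort
  set k : ↥(plaquettesTouching {e}) → G := fun p => staple p.1 e ω with hk
  have hβ0 : 0 < β := hβ₀.trans_le hβ
  have hcu : Continuous (linkCost ρ k) := continuous_linkCost ρ hρ k
  have hwint : Integrable (fun g => Real.exp (-β * linkCost ρ k g)) (haarProbability G) :=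
    (Real.continuous_exp.comp (continuous_const.mul hcu)).integrable_of_hasCompactSupport
      (HasCompactSupport.of_compactSpace _)
  have hZpos : 0 < ∫ g, Real.exp (-β * linkCost ρ k g) ∂(haarProbability G) := by
    obtain ⟨B, hB⟩ : ∃ B, ∀ h, |linkCost ρ k h| ≤ B := by
      obtain ⟨B, hB⟩ := (isCompact_univ.image hcu).isBounded.exists_norm_le
      exact ⟨B, fun h => hB _ ⟨h, Set.mem_univ _, rfl⟩⟩
    have hle : ∀ g, Real.exp (-β * B) ≤ Real.exp (-β * linkCost ρ k g) := fun g =>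
      Real.exp_le_exp.2 (by nlinarith [le_abs_self (linkCost ρ k g), hB g])
    calc (0 : ℝ) < Real.exp (-β * B) := Real.exp_pos _
      _ = ∫ _g, Real.exp (-β * B) ∂(haarProbability G) := by simp
      _ ≤ _ := integral_mono (integrable_const _) hwint hle
  have hk0 : linkCost ρ k (ω e) ≤ θ / β := by
    rw [← wilsonBoundaryAction_update_eq_linkCost ρ hU e ω (ω e), Function.update_eq_self]
    exact hS
  have hcard' : Fintype.card ↥(plaquettesTouching {e}) ≤ m₀ := by rwa [Fintype.card_coe]
  rw [kernel_linkAction_eq_div ρ hρ hU β e ω, div_le_iff₀ hZpos]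
  exact hmean β hβ ↥(plaquettesTouching {e}) k hcard' (ω e) hk0

end Kernel

end Summit.QuantumFields.YangMills.Cruxes.NT.LinkEquipartition

end
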